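import Summits.AtomisticToContinuum.Crystallization.Theorems.ExcessDecayLiouvillePhononStabilityCertPsi
import Summits.AtomisticToContinuum.Crystallization.Theorems.ExcessDecayLiouvillePhononStabilityCertRange
import Summits.AtomisticToContinuum.Crystallization.Theorems.ExcessDecayLiouvillePhononStabilityPullbackBonds

/-!
# Near-certificate layer XII: the exact near range of the target

Support file for crux `PhononStability` (stmt-AtomisticToContinuum-9333), line `contragredient-window-collapse`
(lead c2).  The EXACT finite range `Σ_{‖ζ⁰‖ ≤ Rn} classTerm − 2κ Σ_nn Y_c` of `NearCertificate` is bounded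
below by a computable polynomial pair form `nearPPF`: for every class `c` with `0 < Q(c) ≤ qn = 36 Rn²`

* the checked `ω` lower model of the class (`omegaTermPPF`, `…CertChart.omegaTerm_le`), and
* for the nearest-neighbour classes (`Q(c) = 36`) the `ψ`-term (`psiTermPPF`, `…CertPsi.psiTerm_le`); for the
  other classes the metric term `ψ Y_c ≥ 0` is dropped (`ψ(r) ≥ 0` for `r ≥ 1`, window geometry);
* and for the 24 nearest-neighbour classes the `κ`-term (`kappaTermPPF`, `…CertPsi.kappaTerm_le`),

all under ONE Boolean check `nearChecks` of the per-class model data (radii dominate `|Δρ_c|` on the cell box via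
`spBound` of the normalised `rhoPoly`, model validity via `nonnegDoubleRoot`, `|Q| ≤ q`), and the cell-membership hypothesis
`|x_v| ≤ hbox v`. [folklore]
-/

noncomputable section

open scoped BigOperators Classical InnerProductSpace
open Filter Set Function
open Summit.AtomisticToContinuum.Crystallization.Theorems.PhononStabilityNegative

namespace Summit.AtomisticToContinuum.Crystallization.Theorems.PhononStabilityCWC.Cert

local notation "E3" => EuclideanSpace ℝ (Fin 3)

/-! ## Per-class model data and the checks -/

/-- per-class model data of the near range: `ω` lower model and its radius, `ψ` lower model and its absolute bound -/
structure NearData where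
  /-- `ω̃` lower model of the class (univariate in `Δρ_c`) -/
  omP : BondClass → UPoly
  /-- model radius `h_c ≥ |Δρ_c|` on the cell -/
  omH : BondClass → ℚ
  /-- `ψ̃` lower model (nearest-neighbour classes) -/
  psQ : BondClass → UPoly
  /-- `|Q| ≤ q` on the radius -/
  psAbs : BondClass → ℚ

/-- the box list `[(v, hbox v) : v = 1 … 15]` used for monomial bounds -/
def boxList (hbox : ℕ → ℚ) : List (ℕ × ℚ) := (List.range 15).map fun i => (i + 1, hbox (i + 1))

/-- the strain half-widths as a `Fin 6` vector -/
def hsOf (hbox : ℕ → ℚ) : Fin 6 → ℚ := fun v => hbox (sv v)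

/-- the near-range term of one class -/
def nearTermPPF (C : CellData) (Hc : Mat) (hbox : ℕ → ℚ) (nd : NearData) (c : BondClass) : PolyPF :=
  omegaTermPPF C c (nd.omP c) ++
    (if Qint c = 36 then psiTermPPF C Hc (hsOf hbox) c (nd.psQ c) (nd.psAbs c) else [])

/-- **`nearPPF`:** the near range `(0, qn]` plus the `κ`-terms of the 24 nearest-neighbour classes. -/
def nearPPF (C : CellData) (Hc : Mat) (hbox : ℕ → ℚ) (nd : NearData) (qn : ℤ) (κ : ℚ) : PolyPF :=
  ((classRange 0 qn).flatMap fun c => nearTermPPF C Hc hbox nd c) ++ nnList.flatMap fun c => kappaTermPPF Hc (hsOf hbox) κ c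

/-- the per-class checks of the near data on the cell box -/
def nearChecks (C : CellData) (hbox : ℕ → ℚ) (nd : NearData) (qn : ℤ) : Bool :=
  (classRange 0 qn).all fun c =>
    spListed (boxList hbox) (spNorm (rhoPoly C c)) && decide (spBound (boxList hbox) (spNorm (rhoPoly C c)) ≤ nd.omH c) &&
      nonnegDoubleRoot (omegaNum (C.rhoc c) (nd.omP c)) (nd.omH c) &&
        (if Qint c = 36 then
          nonnegDoubleRoot (psiNum (C.rhoc c) (nd.psQ c)) (nd.omH c) && decide (uAbsBound (nd.psQ c) (nd.omH c) ≤ nd.psAbs c)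
        else true)

/-! ## Classes of the range: non-diagonal, positive length, `ψ ≥ 0` off the first shell -/

/-- `Q ≥ 0`. [folklore] -/
theorem qint_nonneg (c : BondClass) : 0 ≤ Qint c := by unfold Qint; positivity

/-- `Q(c) = 0` only for diagonal classes. [folklore] -/
theorem diag_of_qint_eq_zero {c : BondClass} (h : Qint c = 0) : diagClass c := by
  obtain ⟨m, m', n⟩ := c
  unfold Qint at h
  simp only at h
  have h1 : 2 * n 0 + n 1 + (subSignZ m' - subSignZ m) = 0 := by nlinarith
  have h2 : 3 * n 1 + (subSignZ m' - subSignZ m) = 0 := by nlinarith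
  have h3 : 2 * n 2 + (subSignZ m' - subSignZ m) = 0 := by nlinarith
  unfold subSignZ at h1 h2 h3
  unfold diagClass
  fin_cases m <;> fin_cases m' <;> simp at h1 h2 h3 ⊢ <;> (try omega) <;>
    (funext i; fin_cases i <;> simp <;> omega)

/-- classes of the range are non-diagonal. [folklore] -/
theorem not_diag_of_qint_pos {c : BondClass} (h : 0 < Qint c) : ¬ diagClass c := by
  rintro ⟨h1, h2⟩
  obtain ⟨m, m', n⟩ := c
  simp only at h1 h2
  subst h1; subst h2
  simp [Qint] at h

/-- positive actual length on the window for non-diagonal classes. [folklore] -/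
theorem norm_map_bondVec_pos {A : E3 →L[ℝ] E3} {δ : E3} (hW : CellWindow A) (hδ : ShiftWindow A δ)
    {c : BondClass} (hc : ¬ diagClass c) : 0 < ‖A (bondVec δ c)‖ := by
  have h1 : 1 ≤ ‖bondVec 0 c‖ := PullbackStub.one_le_norm_bondVec_zero hc
  have h2 := norm_bondVec_ge hW hδ c
  have h3 := (hW (bondVec δ c)).1
  nlinarith

/-- `ψ(r) ≥ 0` for `r ≥ 1`. [folklore] -/
theorem psiLJ_nonneg_of_one_le {r : ℝ} (hr : 1 ≤ r) : 0 ≤ psiLJ r := by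
  have hr0 : 0 < r := by linarith
  have hi0 : 0 ≤ r⁻¹ := by positivity
  have hi1 : r⁻¹ ≤ 1 := inv_le_one_of_one_le₀ hr
  have : r⁻¹ ^ 14 ≤ r⁻¹ ^ 8 := pow_le_pow_of_le_one hi0 hi1 (by norm_num)
  unfold psiLJ; linarith

/-- nearest-neighbour classes have `Q = 36`. [folklore] -/
theorem qint_eq_36_of_mem_nnClasses {c : BondClass} (hc : c ∈ nnClasses) : Qint c = 36 := by
  rw [← nnList_toFinset, List.mem_toFinset] at hc
  revert c; decide

/-- off the first shell the metric term is nonnegative: `ψ(‖Aζ_c‖) ≥ 0` for non-diagonal `c ∉ nnClasses`. [folklore] -/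
theorem psiLJ_nonneg_shell {A : E3 →L[ℝ] E3} {δ : E3} (hW : CellWindow A) (hδ : ShiftWindow A δ)
    {c : BondClass} (hc : ¬ diagClass c) (hnn : c ∉ nnClasses) : 0 ≤ psiLJ ‖A (bondVec δ c)‖ := by
  obtain ⟨-, -, -, hfar⟩ := WindowStub.stub_window A δ hW hδ
  have h := hfar c hc hnn
  exact psiLJ_nonneg_of_one_le (by linarith)

/-! ## The exact range as a list sum -/

/-- a function vanishing on diagonal classes sums over `classesR Rn` as over `classRange 0 qn`. [folklore] -/
theorem sum_classesR_eq {Rn : ℝ} {b : ℕ} {qn : ℤ} (hb : ⌈2 * Rn⌉₊ + 1 = b) (hq : ((qn : ℤ) : ℝ) = 36 * Rn ^ 2)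
    (hRn : 0 ≤ Rn) (f : BondClass → ℝ) (hf : ∀ c, diagClass c → f c = 0) :
    ∑ c ∈ classesR Rn, f c = ((classRange 0 qn).map f).sum := by
  rw [← List.sum_toFinset _ (nodup_classRange 0 qn)]
  symm
  refine Finset.sum_subset (fun c hc => ?_) (fun c hc hn => ?_)
  · rw [List.mem_toFinset] at hc
    obtain ⟨-, h2⟩ := qint_of_mem_classRange hc
    rw [mem_classesR_iff hb hq hRn]
    exact ⟨mem_boxFin_of_qint_le hb hq hRn h2, h2⟩
  · rw [mem_classesR_iff hb hq hRn] at hc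
    rw [List.mem_toFinset] at hn
    have h0 : Qint c = 0 := by
      by_contra h0
      exact hn (mem_classRange_of_qint (lt_of_le_of_ne (qint_nonneg c) (Ne.symm h0)) hc.2)
    exact hf c (diag_of_qint_eq_zero h0)

/-- the class term vanishes on diagonal classes. [folklore] -/
theorem classTerm_diag (A B : E3 →L[ℝ] E3) (δ : E3) (w : Label → E3) {c : BondClass} (hc : diagClass c) :
    classTerm A B δ w c = 0 := by
  obtain ⟨m, m', n⟩ := c
  obtain ⟨h1, h2⟩ := hc
  simp only at h1 h2
  subst h1; subst h2
  simp [classTerm, longForm, metricForm, bondDiff]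

/-- the strain box from the cell membership. [folklore] -/
theorem strain_box_of_cell (C : CellData) (hbox : ℕ → ℚ) {A B : E3 →L[ℝ] E3} {δ : E3}
    (hcell : ∀ p ∈ boxList hbox, |chartX C A B δ p.1| ≤ (p.2 : ℝ)) : ∀ v : Fin 6, |chartX C A B δ (sv v)| ≤ hsOf hbox v := by
  intro v
  have hmem : (sv v, hbox (sv v)) ∈ boxList hbox := by
    unfold boxList sv
    rw [List.mem_map]
    exact ⟨v.val, List.mem_range.mpr (by have := v.isLt; omega), rfl⟩
  exact hcell _ hmem

/-! ## Validity -/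

section Validity

variable (C : CellData) (Hc : Mat) (hbox : ℕ → ℚ) (nd : NearData) {A B : E3 →L[ℝ] E3} {δ : E3}
  (hW : CellWindow A) (hδ : ShiftWindow A δ) (hAB : Contragredient A B)
  (hinv : matEqB (mmul Hc C.G) oneQ = true) (hsym : matEqB (mtrans Hc) Hc = true)
  (hcell : ∀ p ∈ boxList hbox, |chartX C A B δ p.1| ≤ (p.2 : ℝ))
  {w : Label → E3} (hw : (support w).Finite)

include hW hδ hAB hinv hsym hcell hw

/-- **validity of one near-range term.** -/
theorem nearTerm_le {qn : ℤ} (hchk : nearChecks C hbox nd qn = true) {c : BondClass} (hc : c ∈ classRange 0 qn) :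
    evalPPF (nearTermPPF C Hc hbox nd c) (chartX C A B δ) w ≤ classTerm A B δ w c := by
  -- unpack the checks for `c`
  unfold nearChecks at hchk
  rw [List.all_eq_true] at hchk
  have hcc := hchk c hc
  simp only [Bool.and_eq_true, decide_eq_true_eq] at hcc
  obtain ⟨⟨⟨hlisted, hrad⟩, hom⟩, hps⟩ := hcc
  -- the model radius dominates |Δρ_c|
  have hQpos : 0 < Qint c := (qint_of_mem_classRange hc).1
  have hnd : ¬ diagClass c := not_diag_of_qint_pos hQpos
  have hpos : 0 < ‖A (bondVec δ c)‖ := norm_map_bondVec_pos hW hδ hnd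
  have hrho := rho_eq chartIdentities C A B δ c
  have hth : |‖A (bondVec δ c)‖ ^ 2 - C.rhoc c| ≤ (nd.omH c : ℝ) := by
    have h1 := abs_spEval_le (boxList hbox) (chartX C A B δ) hcell (spNorm (rhoPoly C c)) hlisted
    have h2 : ((spBound (boxList hbox) (spNorm (rhoPoly C c)) : ℚ) : ℝ) ≤ nd.omH c := by exact_mod_cast hrad
    rw [spEval_spNorm] at h1
    rw [show ‖A (bondVec δ c)‖ ^ 2 - C.rhoc c = spEval (rhoPoly C c) (chartX C A B δ) by linarith]
    exact h1.trans h2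
  have homega := omegaTerm_le chartIdentities C A B δ c (nd.omH c) hth hpos hw (nd.omP c) hom
  unfold nearTermPPF
  rw [evalPPF_append]
  unfold classTerm
  by_cases h36 : Qint c = 36
  · rw [if_pos h36]
    rw [if_pos h36] at hps
    simp only [Bool.and_eq_true, decide_eq_true_eq] at hps
    obtain ⟨hpsm, hpsa⟩ := hps
    have hpsi := psiTerm_le C Hc (hsOf hbox) A B δ c hW hAB hinv hsym (strain_box_of_cell C hbox hcell)
      hw (nd.psQ c) (nd.psAbs c) (nd.omH c) hpsm hpsa hth hpos
    linarith
  · rw [if_neg h36, evalPPF_nil, add_zero]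
    have hnn : c ∉ nnClasses := fun h => h36 (qint_eq_36_of_mem_nnClasses h)
    have hψ := psiLJ_nonneg_shell hW hδ hnd hnn
    have hY : 0 ≤ metricForm B c w := tsum_nonneg fun _ => by positivity
    have hψY := mul_nonneg hψ hY
    linarith

/-- **VALIDITY OF THE NEAR RANGE:** `evalPPF nearPPF ≤ Σ_{‖ζ⁰‖ ≤ Rn} classTerm − 2κ Σ_nn Y_c`. -/
theorem near_le {Rn : ℝ} {bn : ℕ} {qn : ℤ} (hbn : ⌈2 * Rn⌉₊ + 1 = bn) (hqn : ((qn : ℤ) : ℝ) = 36 * Rn ^ 2)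
    (hRn : 0 ≤ Rn) {κ : ℚ} (hκ : 0 ≤ κ) (hchk : nearChecks C hbox nd qn = true) :
    evalPPF (nearPPF C Hc hbox nd qn κ) (chartX C A B δ) w ≤
      (∑ c ∈ classesR Rn, classTerm A B δ w c) - 2 * κ * ∑ c ∈ nnClasses, metricForm B c w := by
  unfold nearPPF
  rw [evalPPF_append, evalPPF_flatMap, evalPPF_flatMap,
    sum_classesR_eq hbn hqn hRn _ (fun c hc => classTerm_diag A B δ w hc), sum_nnClasses_eq]
  have h1 : ((classRange 0 qn).map fun c => evalPPF (nearTermPPF C Hc hbox nd c) (chartX C A B δ) w).sum ≤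
      ((classRange 0 qn).map fun c => classTerm A B δ w c).sum :=
    List.sum_le_sum fun c hc => nearTerm_le C Hc hbox nd hW hδ hAB hinv hsym hcell hw hchk hc
  have h2 : (nnList.map fun c => evalPPF (kappaTermPPF Hc (hsOf hbox) κ c) (chartX C A B δ) w).sum ≤
      (nnList.map fun c => -(2 * (κ : ℝ)) * metricForm B c w).sum :=
    List.sum_le_sum fun c _ => kappaTerm_le C Hc (hsOf hbox) A B δ c hW hAB hinv hsym (strain_box_of_cell C hbox hcell) hw κ hκ
  rw [List.sum_map_mul_left] at h2
  linarith

end Validity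

/-- Anchor of this support file (registered stub of the line skeleton, lead c2). -/
theorem stub_certNear : ∀ (c : BondClass), Qint c = 0 → diagClass c :=
  fun _ hc => diag_of_qint_eq_zero hc

end Summit.AtomisticToContinuum.Crystallization.Theorems.PhononStabilityCWC.Cert

end
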